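import Summits.BirchSwinnertonDyer.BirchSwinnertonDyer.Theorems.SignedLowerHalvesSprungLowerDivisibilityAtThreeTypedInputsInconsistentCoprime
import Summits.BirchSwinnertonDyer.BirchSwinnertonDyer.Theorems.SignedLowerHalvesSprungLowerDivisibilityAtThreeSqueezeToCommonZeros
import Summits.BirchSwinnertonDyer.BirchSwinnertonDyer.Theorems.SignedLowerHalvesSprungLowerDivisibilityAtThreeKeyingDoor
import HarnessLib

/-!
# Crux `SprungLowerDivisibilityAtThree` (K1, item stmt-BirchSwinnertonDyer-19875) and its keying-honest guarded child
# `KatoSporadicPosLevelGivenHeldX8C` (item stmt-BirchSwinnertonDyer-23401), line `chromatic-common-zeros`: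
# THE γ-KEYED JOINT COLEMAN–KATO PACKAGE IS EMPTY AT EVERY COPRIME CELL WHOSE `L♭` HAS A ZERO, UNDER THE KEYING-HONEST GUARD
# — the per-pair VACUITY ENGINE for the ∀-package stubs (F-α♮, R♮) and conjuncts (K_spor, S4b-cyc) of the line

LEAD seat `cruxlead-stmt-BirchSwinnertonDyer-19875` gen 6 (prover; D-0154 KEY (147)(a)/(148)(a) row 8; host `pub/bsd-ssimc`),
2026-08-28. `--supports` 19875 `--as helper`; THEOREMS ONLY; route-independent imports. Closes NOTHING, refutes NOTHING: every
hypothesis is a displayed named fact, a displayed per-pair datum, or a displayed package BINDER. **BSD is NOT proved; K1, K_spor,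
S4b-cyc, 23401 are NOT proved.**

## What

Sequel of `…TypedInputsInconsistentCoprime` (p666883), with the γ-keyed joint package as a BINDER instead of the existence fact
`hJ`: under the guard of crux 23401 — Sprung 2012 Thm. 7.14 (`h714`), Thm. 7.16 IN PRINT KEYING (`h716c`), the period unit at `3`
(`h3`) — at ONE instance of the leaf's binders on an X8 pair (cyclotomic `(κ, γ)`, `v ∣ p`, `g`, Honda system, newform `f`, a
RATIONAL period ratio `ϖ`, Sprung pair `(L♯, L♭)`) carrying (R0)'s datum «no common zero of the normalised colours at any
height-one prime» and «`μ(L♭) = 0`, `1 ≤ λ(L♭)`, `L♭(0) ≠ 0`», EVERY γ-keyed joint package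
`(I : Kato2004.IwasawaH1Data W p κ γ) (Cs Cf : SharpFlatColemanKatoData … ♯/♭ I) (Cs.Z = Cf.Z)` is CONTRADICTORY
(`jointPackage_false_of_printedKato_of_coprime_of_flatZero`). Mechanism, all by name: the squeeze S1
(`ChromaticCommonZeros.stub_squeezeToCommonZeros`, p-landed, package as binders) turns the package and the coprimality datum into
the typed leaf's generator shape «`char D.X = (gen)`, `gen^ℚ = ϖ·(L♭·h)^ℚ`» for a γ-keyed `♭`-datum `D` (finite/torsion by Thm.
7.14); the per-datum keying door (`ChromaticKeying.SharpFlatSelmerDualData.generatorShape_iff_contra`, p661746) transports it to a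
contragredient `D′` as «`gen′^ℚ = ϖ·(ι(L♭)·h′)^ℚ`»; Thm. 7.16 in print keying gives `pⁿ·L♭ ∈ char D′.X` (`.of_thm714`); so every
zero of `L♭` off `(p)` is `ι`-paired (`SharpFlatSelmerDualData.invol_mem_of_generatorShape_of_pow_mul_mem_charIdeal`, p662114) — but
the datum produces a PRIVATE, hence `ι`-UNPAIRED, zero of `L♭` (prequel: `exists_heightOne_zero_of_mu_eq_zero_of_one_le_lam`,
coprimality, the X8 functional equation `ChromaticIota.ClassX8.sharp_mem_of_flat_mem_of_subst_flat_mem`). Contradiction.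

Consequence (`cokerBoundIotaOffT_at_of_printedKato_of_coprime_of_flatZero`, `katoFineLowerResidue_at_…`): AT SUCH AN INSTANCE the
bodies of the two registered stubs of the ι-door pair on 23401 (F-α♮ `stub_cokerBoundIotaOffT`, R♮ `stub_katoFineLowerResidueIotaOffTC`)
hold VACUOUSLY under the guard — their content is confined to pairs with no private `♭`-zero (⊇ every pair with a sporadic or
positive-level cyclotomic common zero). This is the x8 pen's CAVEAT on 23401 («consequent still γ-keyed») in kernel form, and
the per-pair currency of the keying-honest guard until the C′ twin route re-keys the consequent.

References: Sprung, JNT 132 (2012) Def. 6.1, Thm. 7.14 with (3), Thm. 7.16, Prop. 7.19, Main Conj. 7.21 [Sprung2012]; Sprung, ANT 11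
(2017) Thm. 4.13 / Cor. 4.14 [Sprung2017]; Kato, Astérisque 295 (2004) Thm. 12.5/12.6 [Kato2004Asterisque]; Greenberg, LNM 1716 §1
[GreenbergLNM1716]; Washington, GTM 83 §7.1, §13.2 [Washington1997]; Greenberg–Vatsal 2000 Rem. 3.4 [GreenbergVatsal2000].
-/

set_option autoImplicit false
-- the problem directory `BirchSwinnertonDyer/BirchSwinnertonDyer` forces the duplicated namespace segment
set_option linter.dupNamespace false

noncomputable section

open scoped Classical NumberField MatrixGroups ModularForm

open NumberField IsDedekindDomain CongruenceSubgroup WeierstrassCurve PowerSeries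
  Literature.NumberTheory.EllipticCurves Literature.NumberTheory.EllipticCurves.ModularForms
  Literature.NumberTheory.EllipticCurves.ZpExtension Literature.NumberTheory.EllipticCurves.Sprung2017
  Literature.NumberTheory.EllipticCurves.Sprung2012 Literature.NumberTheory.EllipticCurves.Rank1Residual
  Literature.NumberTheory.EllipticCurves.IwasawaAlgebra Literature.Barriers.BirchSwinnertonDyer
  Summit.BirchSwinnertonDyer.Rank1Residual.X1.MuLambda

namespace Summit.BirchSwinnertonDyer.BirchSwinnertonDyer.Theorems

namespace ChromaticKeying

section Vacuity

variable (W : WeierstrassCurve ℚ) [W.IsElliptic] [W.IsGloballyMinimal] (p : ℕ) [Fact p.Prime]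
  [ContinuousSMul ℤ_[p] (W.tateModule p)] [Module.Free ℤ_[p] (W.tateModule p)]
  [Module.Finite ℤ_[p] (W.tateModule p)]

/-- **VACUITY ENGINE: under the keying-honest guard, no γ-keyed joint Coleman–Kato package exists at a coprime cell whose `L♭`
has a zero.** Hypotheses: Sprung 2012 Thm. 7.14, Thm. 7.16 in print keying, the period unit at `3` (BY NAME); an X8 pair with ONE
instance of the leaf's binders (`κ, γ, v, g, cneg, c, f, ϖ, L♯, L♭` — `ϖ` rational with `ϖ·Ω_E = Ω_f⁺`); (R0)'s datum at this
instance (no common zero of the normalised colours); `μ(L♭) = 0`, `1 ≤ λ(L♭)`, `L♭(0) ≠ 0`; and a γ-keyed joint package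
`(I, Cs, Cf)` with `Cs.Z = Cf.Z` as BINDERS. Conclusion: `False`. (Squeeze S1 ⟹ leaf shape for a γ-keyed `♭`-datum; keying door
⟹ shape with `ι(L♭)` for a contragredient datum; Thm. 7.16-print ⟹ every zero of `L♭` off `(p)` is `ι`-paired; the datum ⟹ a
private, hence `ι`-unpaired, zero of `L♭`.) [cite: Sprung2012, Def. 6.1 (p. 1495), Thm. 7.14 with (3) and Thm. 7.16 (p. 1504),
Prop. 7.19 and Main Conj. 7.21 (p. 1505)] [cite: Kato2004Asterisque, Thm. 12.5 and Thm. 12.6 (p. 222)] [cite: Sprung2017, Thm. 4.13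
and Cor. 4.14] [cite: GreenbergLNM1716, §1 (p. 60)] [cite: GreenbergVatsal2000, Rem. 3.4] -/
theorem jointPackage_false_of_printedKato_of_coprime_of_flatZero
    (h714 : thm714_sharpFlatSelmerDual_finite_torsion) (h716c : thm716_sharpFlatCharIdeal_divisibility_contra)
    (hper : realPeriodRat_eq_unit_mul_plusPeriod_three) (hX : ClassX8 W p)
    (κ : ZpExtension ℚ p) (γ : Field.absoluteGaloisGroup ℚ)
    (hκ : κ.IsCyclotomic) (hγ : κ.IsTopGenerator γ) (hvar : IsCyclotomicVariable p γ)
    (v : HeightOneSpectrum (𝓞 ℚ)) (hv : (p : 𝓞 ℚ) ∈ v.asIdeal)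
    (g : Field.absoluteGaloisGroup (v.adicCompletion ℚ))
    (hg : κ.IsTopGenerator (resGalOfEmb (closureEmb (K := ℚ) (v.adicCompletion ℚ)) g))
    (cneg : localPoints W (v.adicCompletion ℚ)) (c : ℕ → localPoints W (v.adicCompletion ℚ))
    (hH : IsHondaSystem κ (closureEmb (K := ℚ) (v.adicCompletion ℚ)) W (W.frobeniusTrace p) g cneg c)
    {N : ℕ} [NeZero N] (f : CuspForm (Gamma0 N) 2) (ϖ : ℚ) (Lsharp Lflat : IwasawaAlgebra p)
    (hf : IsNewformOf W f) (hϖ : (ϖ : ℝ) * W.realPeriodRat = plusPeriod f)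
    (hSP : IsSprungPair f p (W.frobeniusTrace p) Lsharp Lflat)
    (hnc : ∀ 𝔭 : PrimeSpectrum (IwasawaAlgebra p), 𝔭.asIdeal.height = 1 →
      ∃ (col' : Chroma) (G' : IwasawaAlgebra p),
        iwasawaToPowerSeries p G' = PowerSeries.C (ϖ : ℚ_[p]) * iwasawaToPowerSeries p (chromaticL col' Lsharp Lflat) ∧
        G' ∉ 𝔭.asIdeal)
    (hμ : mu Lflat = 0) (hlam : 1 ≤ lam Lflat) (hc0 : PowerSeries.constantCoeff Lflat ≠ 0)
    (I : Kato2004.IwasawaH1Data W p κ γ)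
    (Cs : SharpFlatColemanKatoData W p f ϖ κ γ (closureEmb (K := ℚ) (v.adicCompletion ℚ))
      (W.frobeniusTrace p) g c Chroma.sharp I)
    (Cf : SharpFlatColemanKatoData W p f ϖ κ γ (closureEmb (K := ℚ) (v.adicCompletion ℚ))
      (W.frobeniusTrace p) g c Chroma.flat I)
    (hZ : Cs.Z = Cf.Z) : False := by
  have hp2 : p ≠ 2 := by rw [hX.p_eq]; decide
  have hgood : W.HasGoodReductionAtPrime p :=
    Summit.BirchSwinnertonDyer.Rank1Residual.Supersingular.ClassX8.good W p hX
  have hss : (p : ℤ) ∣ W.frobeniusTrace p :=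
    Summit.BirchSwinnertonDyer.Rank1Residual.Supersingular.ClassX8.dvd_frobeniusTrace W p hX
  have hne : chromaticL Chroma.flat Lsharp Lflat ≠ 0 :=
    ChromaticBothColours.ClassX8.chromaticL_ne_zero W p hX f Lsharp Lflat hf hSP Chroma.flat
  -- a γ-keyed `♭`-datum, finitely generated torsion by Thm. 7.14
  obtain ⟨D⟩ := nonempty_sharpFlatSelmerDualData_rat W κ γ v g c Chroma.flat
  haveI : Module.Finite (IwasawaAlgebra p) D.X := h714.moduleFinite hp2 hgood hss hf hκ hγ hvar hv hg hH hSP hne D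
  have htor : Module.IsTorsion (IwasawaAlgebra p) D.X := h714.isTorsion hp2 hgood hss hf hκ hγ hvar hv hg hH hSP hne D
  -- the Néron-normalised `G♭ = C(ϖ)·L♭` (`ϖ ∈ ℤ_pˣ` by the period unit)
  have hnorm : ‖(ϖ : ℚ_[p])‖ = 1 := ChromaticCommonZeros.norm_periodRatio_eq_one_of_classX8 hper W p hX f hf ϖ hϖ
  set w : ℤ_[p] := ⟨(ϖ : ℚ_[p]), hnorm.le⟩ with hw_def
  have hcoe : (w : ℚ_[p]) = (ϖ : ℚ_[p]) := rfl
  have hG : iwasawaToPowerSeries p (PowerSeries.C w * chromaticL Chroma.flat Lsharp Lflat) =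
      PowerSeries.C (ϖ : ℚ_[p]) * iwasawaToPowerSeries p (chromaticL Chroma.flat Lsharp Lflat) := by
    rw [ChromaticCommonZeros.iwasawaToPowerSeries_C_mul, hcoe]
  -- squeeze S1: the package + coprimality give the leaf's generator shape for `D`
  have hshape : ∃ gen h : IwasawaAlgebra p, D.charIdeal = Ideal.span {gen} ∧
      iwasawaToPowerSeries p gen =
        PowerSeries.C (ϖ : ℚ_[p]) * iwasawaToPowerSeries p (chromaticL Chroma.flat Lsharp Lflat * h) :=
    ChromaticCommonZeros.stub_squeezeToCommonZeros W p hX Chroma.flat κ γ hκ hγ hvar v hv g hg cneg c hH N ‹_› f ϖ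
      Lsharp Lflat hf hϖ hSP hne D htor _ hG I Cs Cf hZ (by
        intro 𝔭 h𝔭 hcommon
        obtain ⟨col', G', hG', hG'𝔭⟩ := hnc 𝔭 h𝔭
        exact absurd (hcommon col' G' hG') hG'𝔭)
  -- keying door: the same shape for a contragredient datum `D′`, with `ι(L♭)`
  obtain ⟨D'⟩ := nonempty_sharpFlatSelmerDualData_rat W κ γ⁻¹ v g c Chroma.flat
  have hshape' : ∃ gen h : IwasawaAlgebra p, D'.charIdeal = Ideal.span {gen} ∧
      iwasawaToPowerSeries p gen =
        PowerSeries.C ((ϖ : ℚ) : ℚ_[p]) * iwasawaToPowerSeries p (invol p (chromaticL Chroma.flat Lsharp Lflat) * h) :=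
    (SharpFlatSelmerDualData.generatorShape_iff_contra D D' (ϖ : ℚ_[p]) (chromaticL Chroma.flat Lsharp Lflat)).1 hshape
  -- Thm. 7.16 in print keying for `D′` (torsion fed by Thm. 7.14)
  have hKato : ∃ n : ℕ, (p : IwasawaAlgebra p) ^ n * chromaticL Chroma.flat Lsharp Lflat ∈ D'.charIdeal :=
    (h716c.of_thm714 h714 hp2 hgood hss hf hκ hγ hvar hv hg hH hSP hne D').1
  -- the datum's zero of `L♭` off `(p), (T)` is private, hence `ι`-unpaired …
  have hF0 : Lflat ≠ 0 := fun h => hc0 (by rw [h, map_zero])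
  obtain ⟨𝔭₀, h1, hp𝔭₀, hT𝔭₀, hLf⟩ := exists_heightOne_zero_of_mu_eq_zero_of_one_le_lam hF0 hμ hlam hc0
  obtain ⟨col', G', hG', hG'𝔭⟩ := hnc 𝔭₀ h1
  have hGeq : G' = PowerSeries.C w * chromaticL col' Lsharp Lflat :=
    iwasawaToPowerSeries_injective p (by rw [hG', ChromaticCommonZeros.iwasawaToPowerSeries_C_mul, hcoe])
  have hLcol' : chromaticL col' Lsharp Lflat ∉ 𝔭₀.asIdeal := fun hmem => hG'𝔭 (hGeq ▸ Ideal.mul_mem_left _ _ hmem)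
  have hLs : Lsharp ∉ 𝔭₀.asIdeal := by
    cases col' with
    | sharp => rwa [chromaticL_sharp] at hLcol'
    | flat => exact absurd (by rwa [chromaticL_flat] at hLcol' : Lflat ∉ 𝔭₀.asIdeal) (not_not_intro hLf)
  have hL : chromaticL Chroma.flat Lsharp Lflat ∈ 𝔭₀.asIdeal := by rw [chromaticL_flat]; exact hLf
  have hιL : invol p (chromaticL Chroma.flat Lsharp Lflat) ∉ 𝔭₀.asIdeal := by
    rw [chromaticL_flat, invol_eq_subst]
    intro hι
    exact hLs (ChromaticIota.ClassX8.sharp_mem_of_flat_mem_of_subst_flat_mem W p hX f hf Lsharp Lflat hSP 𝔭₀.asIdeal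
      𝔭₀.isPrime hp𝔭₀ hT𝔭₀ hLf hι)
  -- … while the shape + Kato pair every zero of `L♭` off `(p)`
  exact hιL (SharpFlatSelmerDualData.invol_mem_of_generatorShape_of_pow_mul_mem_charIdeal D' hshape' hKato 𝔭₀ hp𝔭₀ hL)

/-- **COROLLARY (stub F-α♮ of the ι-door pair, AT SUCH AN INSTANCE, vacuously).** Under the guard and the datum of the engine,
the body of the registered stub `stub_cokerBoundIotaOffT` (23401 / 22569 / 22901 / 22570) holds at this instance for every
γ-keyed joint package, every fine datum `Y` and every prime — there is no package. [cite: Sprung2012, Thm. 7.14 and Thm. 7.16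
(p. 1504)] [cite: Matar2020, Thm. 1.1 (context: the non-vacuous reduction is w2 g9's by-mass file)] -/
theorem cokerBoundIotaOffT_at_of_printedKato_of_coprime_of_flatZero
    (h714 : thm714_sharpFlatSelmerDual_finite_torsion) (h716c : thm716_sharpFlatCharIdeal_divisibility_contra)
    (hper : realPeriodRat_eq_unit_mul_plusPeriod_three) (hX : ClassX8 W p)
    (κ : ZpExtension ℚ p) (γ : Field.absoluteGaloisGroup ℚ)
    (hκ : κ.IsCyclotomic) (hγ : κ.IsTopGenerator γ) (hvar : IsCyclotomicVariable p γ)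
    (v : HeightOneSpectrum (𝓞 ℚ)) (hv : (p : 𝓞 ℚ) ∈ v.asIdeal)
    (g : Field.absoluteGaloisGroup (v.adicCompletion ℚ))
    (hg : κ.IsTopGenerator (resGalOfEmb (closureEmb (K := ℚ) (v.adicCompletion ℚ)) g))
    (cneg : localPoints W (v.adicCompletion ℚ)) (c : ℕ → localPoints W (v.adicCompletion ℚ))
    (hH : IsHondaSystem κ (closureEmb (K := ℚ) (v.adicCompletion ℚ)) W (W.frobeniusTrace p) g cneg c)
    {N : ℕ} [NeZero N] (f : CuspForm (Gamma0 N) 2) (ϖ : ℚ) (Lsharp Lflat : IwasawaAlgebra p)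
    (hf : IsNewformOf W f) (hϖ : (ϖ : ℝ) * W.realPeriodRat = plusPeriod f)
    (hSP : IsSprungPair f p (W.frobeniusTrace p) Lsharp Lflat)
    (hnc : ∀ 𝔭 : PrimeSpectrum (IwasawaAlgebra p), 𝔭.asIdeal.height = 1 →
      ∃ (col' : Chroma) (G' : IwasawaAlgebra p),
        iwasawaToPowerSeries p G' = PowerSeries.C (ϖ : ℚ_[p]) * iwasawaToPowerSeries p (chromaticL col' Lsharp Lflat) ∧
        G' ∉ 𝔭.asIdeal)
    (hμ : mu Lflat = 0) (hlam : 1 ≤ lam Lflat) (hc0 : PowerSeries.constantCoeff Lflat ≠ 0)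
    (I : Kato2004.IwasawaH1Data W p κ γ)
    (Cs : SharpFlatColemanKatoData W p f ϖ κ γ (closureEmb (K := ℚ) (v.adicCompletion ℚ))
      (W.frobeniusTrace p) g c Chroma.sharp I)
    (Cf : SharpFlatColemanKatoData W p f ϖ κ γ (closureEmb (K := ℚ) (v.adicCompletion ℚ))
      (W.frobeniusTrace p) g c Chroma.flat I)
    (hZ : Cs.Z = Cf.Z) (Y : W.FineSelmerDualData κ γ) (𝔭 : PrimeSpectrum (IwasawaAlgebra p)) :
    min (Module.lengthAt (IwasawaAlgebra p) (IwasawaAlgebra p ⧸ LinearMap.range Cs.colMap) 𝔭)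
        (Module.lengthAt (IwasawaAlgebra p) (IwasawaAlgebra p ⧸ LinearMap.range Cf.colMap) 𝔭) ≤
      Module.lengthAt (IwasawaAlgebra p) Y.X (PrimeSpectrum.comap (invol p).toRingHom 𝔭) :=
  (jointPackage_false_of_printedKato_of_coprime_of_flatZero W p h714 h716c hper hX κ γ hκ hγ hvar v hv g hg cneg c hH f ϖ
    Lsharp Lflat hf hϖ hSP hnc hμ hlam hc0 I Cs Cf hZ).elim

/-- **COROLLARY (stub R♮ / K_spor at such an instance, vacuously)**: Kato's fine lower bound `ℓ_𝔭(𝐇¹/Z) ≤ ℓ_𝔭 Y.X` at EVERY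
prime, for every γ-keyed package and fine datum at such an instance — no package exists. [cite: Kato2004Asterisque, Conj. 12.10
(p. 224) (the shape only)] [cite: Sprung2012, Thm. 7.14 and Thm. 7.16 (p. 1504)] -/
theorem katoFineLowerAt_at_of_printedKato_of_coprime_of_flatZero
    (h714 : thm714_sharpFlatSelmerDual_finite_torsion) (h716c : thm716_sharpFlatCharIdeal_divisibility_contra)
    (hper : realPeriodRat_eq_unit_mul_plusPeriod_three) (hX : ClassX8 W p)
    (κ : ZpExtension ℚ p) (γ : Field.absoluteGaloisGroup ℚ)
    (hκ : κ.IsCyclotomic) (hγ : κ.IsTopGenerator γ) (hvar : IsCyclotomicVariable p γ)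
    (v : HeightOneSpectrum (𝓞 ℚ)) (hv : (p : 𝓞 ℚ) ∈ v.asIdeal)
    (g : Field.absoluteGaloisGroup (v.adicCompletion ℚ))
    (hg : κ.IsTopGenerator (resGalOfEmb (closureEmb (K := ℚ) (v.adicCompletion ℚ)) g))
    (cneg : localPoints W (v.adicCompletion ℚ)) (c : ℕ → localPoints W (v.adicCompletion ℚ))
    (hH : IsHondaSystem κ (closureEmb (K := ℚ) (v.adicCompletion ℚ)) W (W.frobeniusTrace p) g cneg c)
    {N : ℕ} [NeZero N] (f : CuspForm (Gamma0 N) 2) (ϖ : ℚ) (Lsharp Lflat : IwasawaAlgebra p)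
    (hf : IsNewformOf W f) (hϖ : (ϖ : ℝ) * W.realPeriodRat = plusPeriod f)
    (hSP : IsSprungPair f p (W.frobeniusTrace p) Lsharp Lflat)
    (hnc : ∀ 𝔭 : PrimeSpectrum (IwasawaAlgebra p), 𝔭.asIdeal.height = 1 →
      ∃ (col' : Chroma) (G' : IwasawaAlgebra p),
        iwasawaToPowerSeries p G' = PowerSeries.C (ϖ : ℚ_[p]) * iwasawaToPowerSeries p (chromaticL col' Lsharp Lflat) ∧
        G' ∉ 𝔭.asIdeal)
    (hμ : mu Lflat = 0) (hlam : 1 ≤ lam Lflat) (hc0 : PowerSeries.constantCoeff Lflat ≠ 0)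
    (I : Kato2004.IwasawaH1Data W p κ γ)
    (Cs : SharpFlatColemanKatoData W p f ϖ κ γ (closureEmb (K := ℚ) (v.adicCompletion ℚ))
      (W.frobeniusTrace p) g c Chroma.sharp I)
    (Cf : SharpFlatColemanKatoData W p f ϖ κ γ (closureEmb (K := ℚ) (v.adicCompletion ℚ))
      (W.frobeniusTrace p) g c Chroma.flat I)
    (hZ : Cs.Z = Cf.Z) (Y : W.FineSelmerDualData κ γ) (𝔭 : PrimeSpectrum (IwasawaAlgebra p)) :
    Module.lengthAt (IwasawaAlgebra p) (I.H ⧸ Cs.Z) 𝔭 ≤ Module.lengthAt (IwasawaAlgebra p) Y.X 𝔭 :=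
  (jointPackage_false_of_printedKato_of_coprime_of_flatZero W p h714 h716c hper hX κ γ hκ hγ hvar v hv g hg cneg c hH f ϖ
    Lsharp Lflat hf hϖ hSP hnc hμ hlam hc0 I Cs Cf hZ).elim

end Vacuity

end ChromaticKeying

end Summit.BirchSwinnertonDyer.BirchSwinnertonDyer.Theorems

end
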